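/-
Copyright (c) 2026 the pub-hodgecm-mathlib formalisation cell (harness21).  Prover seat hodgecm-mathlib-K2E1-p11 (g4), Track B ∕ K2-LIT, h413 = `stmt-HodgeConjecture-24833`,
R90-TF section S8 «ContSpec-n½», #2 road (G side), S8 dealer R90-CS-plan (g3) S8-R181 («2b export list = the concrete level (K′ = ι(K_∞)·ι_f(K_f), ω) with the level facts»): FILE 3d —
THE LEVEL OF RECORD.  `J₃`-centro-symmetry of the archimedean maximal compact `K_∞` (`k J₃ = J₃ k` for `k` unitary AND in `U(J₃)`) makes the last-row functional MULTIPLICATIVE,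
`ℓ(a·k) = ℓ(a)·ℓ(k)`, hence the section of record multiplicative, `Φa(a·k) = Φa(a)·Φa(k)` (★ 3c-E: `ρ_E ≡ 1`, `Θ` multiplicative on ideles): `φ(g) = Φa(g_∞)Φf(g_f)` has level
`K′ = levelOfRecord K_f = {k ∈ K | k_f ∈ K_f}` with right character `ω = omegaOfRecord = Φa ∘ (·)_∞` (★ ED. 4), `ω = 1` on `ι_f(K_f)`, `ι(K_∞) ⊆ K′ ≤ K`.
-/
import Summits.HodgeConjecture.HodgeConjecture.Theorems.R90S8ChiSectionPairArchSectionWitnessEU3   -- ★ (this seat) 3c-E: isotropy, `archSectionE_eq`, `continuous_archSectionE`, hΦaB, `archSectionE_one`; brings 2b ∕ 3c ∕ … ∕ Defs (ED. 4)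
import HarnessLib

/-!
# S8 #2 road (G side) — `R90S8ChiSectionPairLevelOfRecordU3`: `ℓ(a·k) = ℓ(a)·ℓ(k)` on `K_∞`, `Φa|K_∞` is a character, and THE WITNESS AT THE LEVEL OF RECORD `(levelOfRecord K(𝔫), omegaOfRecord)`

WHAT THIS FILE DOES (vocabulary: ★ ED. 3 `archSectionE` = `Φa`; ★ ED. 4 `levelOfRecord`, `omegaOfRecord`; ★ `standardMaximalCompactGL` = `K`; ★ `finCongruenceLevel` = `K(𝔫)_f`; ★ `chiSectionSpacePair`).
* §1 `K_∞` COMMUTES WITH `J₃` place by place (`evalC_map_mul_antidiagonal_eq`: `k_wᴴ k_w = 1` ★ `mem_Kinf_iff` and `k_wᴴ J₃ k_w = J₃` ★ `mem_arch_iff_forall`), whence the centro-symmetries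
  `(k_w)₁₂ = (k_w)₁₀`, `(k_w)₀₂ = (k_w)₂₀`, `(k_w)₀₀ = (k_w)₂₂`.
* §2 **`archLastRowL_mul_of_mem`**: `ℓ(a·k) = ℓ(a)·ℓ(k)` in `𝔸_L` for `ι(k) ∈ K`; `isUnit_archLastRowL`; `lastRowChar_mul_of_isUnit`; **`archSectionE_mul_of_mem`**: `Φa(a·k) = Φa(a)·Φa(k)`.
* §3 Level facts: `levelOfRecord_le` (`K′ ≤ K`, the binder `hK'`), `archToAdelic_mem_levelOfRecord` (`hKinf`), `finAdelicToAdelic_mem_levelOfRecord`, `omegaOfRecord_finAdelicToAdelic` (`ω = 1` on `ι_f(K_f)`,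
  the binder `hU` with `U₀ = K(𝔫)_f`), `adelicVal_archToAdelic_archPart_mem` (`k ∈ K ⇒ k_∞ ∈ K_∞`).
* §4 **`archFin_mem_chiSectionSpacePair_levelOfRecord`**: `g ↦ Φa(g_∞)·Φf(g_f)` lies in `chiSectionSpacePair χ₁ χ₂ (levelOfRecord K_f) (omegaOfRecord χ₁ χ₂ K_f)` for any right-`K_f`-invariant finite
  section `Φf` with the Borel law; **`exists_mem_chiSectionSpacePair_levelOfRecord`** (at `K_f = K(𝔫)_f` with the conductor condition) and the hypothesis-free
  **`exists_level_mem_chiSectionSpacePair_levelOfRecord (χ₁ χ₂) : ∃ 𝔫 ≠ 0, ∃ φ, φ ∈ chiSectionSpacePair χ₁ χ₂ (levelOfRecord K(𝔫)_f) (omegaOfRecord χ₁ χ₂ K(𝔫)_f) ∧ Continuous φ ∧ φ 1 = 1 ∧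
  ∀ a, φ (ι a) = Φa a`** (★ 2b conductor level).
HONEST LABEL: HC_CM is proved only modulo the 7 printed citations (2 remaining named inputs: hLiu418 = `stmt-HodgeConjecture-24832`, h413 = `stmt-HodgeConjecture-24833`) until rung 0
closes; REL ≠ ★ ≠ BUILT; this file asserts no named fact and closes no socket; the level-intrinsic binders `hVc`, `bV` (all sections continuous, finite basis) are NOT here; count-neutral.

## References
* [BorelJacquet1979] A. Borel, H. Jacquet, *Automorphic forms and automorphic representations*, Corvallis PSPM 33.1 (1979), §4.1.
* [Rogawski1990] J. D. Rogawski, *Automorphic Representations of Unitary Groups in Three Variables* (1990), §1.9–§1.10.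
* [MoeglinWaldspurger1995] C. Mœglin, J.-L. Waldspurger, *Spectral Decomposition and Eisenstein Series* (1995), I.2.17.
-/

set_option autoImplicit false
set_option linter.dupNamespace false  -- the mandated namespace `…HodgeConjecture.HodgeConjecture.R90.S8` (LEAD #1 L1) repeats the summit's segment

noncomputable section

open NumberField IsDedekindDomain Topology Filter ComplexConjugate
open scoped Matrix
open Literature.NumberTheory.Automorphic Literature.NumberTheory.Automorphic.UnitaryGroup Literature.NumberTheory.GaloisRepresentations AdelicGroupData
open Literature.NumberTheory.Automorphic.Arthur2013.Leaves.TECR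
open Literature.NumberTheory.Automorphic.UnitaryGroup.AdelicCharactersDetQuasiSplit (antidiagonal_over_det_ne_zero)
open Summit.HodgeConjecture.HodgeConjecture.Cruxes.H413.K2E1CharacterEisensteinU2Defs
open Summit.HodgeConjecture.HodgeConjecture.Cruxes.H413.K2E1CharacterEisensteinU3PairDefs
open Summit.HodgeConjecture.HodgeConjecture.Cruxes.H413.K2E1ChiSectionSpaceU3PairDefs

namespace Summit.HodgeConjecture.HodgeConjecture.R90.S8

variable (L : Type) [Field L] [NumberField L] [IsCMField L]

/-! ## §1 `K_∞` commutes with `J₃` -/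

/-- **`k_w J₃ = J₃ k_w`** at every place, for `k ∈ G_∞` with `ι(k) ∈ K` (`k_w` unitary, ★ `mem_Kinf_iff`, and `k_wᴴ J₃ k_w = J₃`, ★ `mem_arch_iff_forall`). [cite: Rogawski1990, §1.9] -/
theorem evalC_map_mul_antidiagonal_eq (k : arch (↥(maximalRealSubfield L)) L (IsCMField.complexConj L) 3 ((StdForm.antidiagonal 3).over L))
    (hk : adelicVal (↥(maximalRealSubfield L)) L (IsCMField.complexConj L) 3 ((StdForm.antidiagonal 3).over L)
      (archToAdelic (↥(maximalRealSubfield L)) L (IsCMField.complexConj L) 3 ((StdForm.antidiagonal 3).over L) k) ∈ standardMaximalCompactGL 3 L) (w : InfinitePlace L) :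
    ((k : GL (Fin 3) (mixedEmbedding.mixedSpace L)) : Matrix (Fin 3) (Fin 3) (mixedEmbedding.mixedSpace L)).map (evalC L ⟨w, IsTotallyComplex.isComplex w⟩) * (StdForm.antidiagonal 3).over ℂ =
      (StdForm.antidiagonal 3).over ℂ * ((k : GL (Fin 3) (mixedEmbedding.mixedSpace L)) : Matrix (Fin 3) (Fin 3) (mixedEmbedding.mixedSpace L)).map (evalC L ⟨w, IsTotallyComplex.isComplex w⟩) := by
  set M : Matrix (Fin 3) (Fin 3) ℂ := ((k : GL (Fin 3) (mixedEmbedding.mixedSpace L)) : Matrix (Fin 3) (Fin 3) (mixedEmbedding.mixedSpace L)).map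
    (evalC L ⟨w, IsTotallyComplex.isComplex w⟩) with hM
  -- unitarity at `w`
  have hKinf : (k : GL (Fin 3) (mixedEmbedding.mixedSpace L)) ∈ Kinf 3 L := by
    have h := toMixed_mem_Kinf_of_mem_standardMaximalCompactGL hk
    rwa [adelicVal_archToAdelic, GLn.toMixed_ofInfinite] at h
  have hU := ((mem_Kinf_iff 3 L _).1 hKinf).2 ⟨w, IsTotallyComplex.isComplex w⟩
  rw [mem_unitarySubgroupGL_iff, Matrix.star_eq_conjTranspose] at hU
  change Mᴴ * M = 1 at hU
  -- the form relation at `w`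
  have hmem := (mem_arch_iff_forall (↥(maximalRealSubfield L)) L (IsCMField.complexConj L) 3 ((StdForm.antidiagonal 3).over L)
    (IsCMField.complexConj_ne_one L) (complexConj_smul_infinitePlace L) (k : GL (Fin 3) (mixedEmbedding.mixedSpace L))).1 k.2 ⟨w, IsTotallyComplex.isComplex w⟩
  rw [mem_archLocal_iff_conjTranspose, StdForm.over_map] at hmem
  change Mᴴ * (StdForm.antidiagonal 3).over ℂ * M = (StdForm.antidiagonal 3).over ℂ at hmem
  have hU' : M * Mᴴ = 1 := mul_eq_one_comm.1 hU
  calc M * (StdForm.antidiagonal 3).over ℂ = M * (Mᴴ * (StdForm.antidiagonal 3).over ℂ * M) := by rw [hmem]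
    _ = (M * Mᴴ) * (StdForm.antidiagonal 3).over ℂ * M := by simp only [Matrix.mul_assoc]
    _ = (StdForm.antidiagonal 3).over ℂ * M := by rw [hU', Matrix.one_mul]

/-- **Centro-symmetries of `k_w`** for `ι(k) ∈ K`: `(k_w)₁₂ = (k_w)₁₀`, `(k_w)₀₂ = (k_w)₂₀`, `(k_w)₀₀ = (k_w)₂₂`. [cite: Rogawski1990, §1.9] -/
theorem evalC_apply_centro (k : arch (↥(maximalRealSubfield L)) L (IsCMField.complexConj L) 3 ((StdForm.antidiagonal 3).over L))
    (hk : adelicVal (↥(maximalRealSubfield L)) L (IsCMField.complexConj L) 3 ((StdForm.antidiagonal 3).over L)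
      (archToAdelic (↥(maximalRealSubfield L)) L (IsCMField.complexConj L) 3 ((StdForm.antidiagonal 3).over L) k) ∈ standardMaximalCompactGL 3 L) (w : InfinitePlace L) :
    evalC L ⟨w, IsTotallyComplex.isComplex w⟩ (((k : GL (Fin 3) (mixedEmbedding.mixedSpace L)) : Matrix (Fin 3) (Fin 3) (mixedEmbedding.mixedSpace L)) 1 2) =
        evalC L ⟨w, IsTotallyComplex.isComplex w⟩ (((k : GL (Fin 3) (mixedEmbedding.mixedSpace L)) : Matrix (Fin 3) (Fin 3) (mixedEmbedding.mixedSpace L)) 1 0) ∧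
      evalC L ⟨w, IsTotallyComplex.isComplex w⟩ (((k : GL (Fin 3) (mixedEmbedding.mixedSpace L)) : Matrix (Fin 3) (Fin 3) (mixedEmbedding.mixedSpace L)) 0 2) =
        evalC L ⟨w, IsTotallyComplex.isComplex w⟩ (((k : GL (Fin 3) (mixedEmbedding.mixedSpace L)) : Matrix (Fin 3) (Fin 3) (mixedEmbedding.mixedSpace L)) 2 0) ∧
      evalC L ⟨w, IsTotallyComplex.isComplex w⟩ (((k : GL (Fin 3) (mixedEmbedding.mixedSpace L)) : Matrix (Fin 3) (Fin 3) (mixedEmbedding.mixedSpace L)) 0 0) =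
        evalC L ⟨w, IsTotallyComplex.isComplex w⟩ (((k : GL (Fin 3) (mixedEmbedding.mixedSpace L)) : Matrix (Fin 3) (Fin 3) (mixedEmbedding.mixedSpace L)) 2 2) := by
  set M : Matrix (Fin 3) (Fin 3) ℂ := ((k : GL (Fin 3) (mixedEmbedding.mixedSpace L)) : Matrix (Fin 3) (Fin 3) (mixedEmbedding.mixedSpace L)).map
    (evalC L ⟨w, IsTotallyComplex.isComplex w⟩) with hM
  have hcomm := evalC_map_mul_antidiagonal_eq L k hk w
  rw [← hM] at hcomm
  have h10 := congrFun (congrFun hcomm 1) 0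
  have h00 := congrFun (congrFun hcomm 0) 0
  have h02 := congrFun (congrFun hcomm 0) 2
  simp only [Matrix.mul_apply, Fin.sum_univ_three, antidiagonal_three_over_apply] at h10 h00 h02
  simp [Fin.rev, Fin.ext_iff] at h10 h00 h02
  show M 1 2 = M 1 0 ∧ M 0 2 = M 2 0 ∧ M 0 0 = M 2 2
  exact ⟨h10, h00, h02⟩

/-! ## §2 Multiplicativity of `ℓ` and of `Φa` along `K_∞` -/

/-- **`ℓ(a·k) = ℓ(a)·ℓ(k)`** in `𝔸_L` for `a ∈ G_∞` and `ι(k) ∈ K`: at each place `Σⱼ a₂ⱼ(k_{j2} − k_{j0}) = (a₂₂ − a₂₀)(k₂₂ − k₂₀)` by the centro-symmetries of §1 (read in `ℂ` through the isometric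
`ι_w`, ★ `extensionEmbedding_archLastRow_fst`); the finite parts are `1`. [cite: Rogawski1990, §1.10] -/
theorem archLastRowL_mul_of_mem (a k : arch (↥(maximalRealSubfield L)) L (IsCMField.complexConj L) 3 ((StdForm.antidiagonal 3).over L))
    (hk : adelicVal (↥(maximalRealSubfield L)) L (IsCMField.complexConj L) 3 ((StdForm.antidiagonal 3).over L)
      (archToAdelic (↥(maximalRealSubfield L)) L (IsCMField.complexConj L) 3 ((StdForm.antidiagonal 3).over L) k) ∈ standardMaximalCompactGL 3 L) :
    archLastRowL L (a * k) = archLastRowL L a * archLastRowL L k := by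
  refine Prod.ext (funext fun w => ?_) ?_
  · -- archimedean components, read in `ℂ`
    apply (InfinitePlace.Completion.isometry_extensionEmbedding w).injective
    have hsplit : ∀ x : arch (↥(maximalRealSubfield L)) L (IsCMField.complexConj L) 3 ((StdForm.antidiagonal 3).over L),
        InfinitePlace.Completion.extensionEmbedding w ((archLastRowL L x).1 w) =
          evalC L ⟨w, IsTotallyComplex.isComplex w⟩ (((x : GL (Fin 3) (mixedEmbedding.mixedSpace L)) : Matrix (Fin 3) (Fin 3) (mixedEmbedding.mixedSpace L)) 2 2) -
            evalC L ⟨w, IsTotallyComplex.isComplex w⟩ (((x : GL (Fin 3) (mixedEmbedding.mixedSpace L)) : Matrix (Fin 3) (Fin 3) (mixedEmbedding.mixedSpace L)) 2 0) := fun x => by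
      have h : (archLastRowL L x).1 w = (archLastRow L x 2).1 w - (archLastRow L x 0).1 w := rfl
      rw [h, map_sub, extensionEmbedding_archLastRow_fst, extensionEmbedding_archLastRow_fst]
    have hmul : ((archLastRowL L a * archLastRowL L k).1 w) = (archLastRowL L a).1 w * (archLastRowL L k).1 w := rfl
    rw [hmul, map_mul, hsplit, hsplit, hsplit]
    -- the product `a·k` read at `w`
    set A : Matrix (Fin 3) (Fin 3) ℂ := ((a : GL (Fin 3) (mixedEmbedding.mixedSpace L)) : Matrix (Fin 3) (Fin 3) (mixedEmbedding.mixedSpace L)).map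
      (evalC L ⟨w, IsTotallyComplex.isComplex w⟩) with hA
    set M : Matrix (Fin 3) (Fin 3) ℂ := ((k : GL (Fin 3) (mixedEmbedding.mixedSpace L)) : Matrix (Fin 3) (Fin 3) (mixedEmbedding.mixedSpace L)).map
      (evalC L ⟨w, IsTotallyComplex.isComplex w⟩) with hM
    have hAM : ∀ i j, evalC L ⟨w, IsTotallyComplex.isComplex w⟩
        ((((a * k : arch (↥(maximalRealSubfield L)) L (IsCMField.complexConj L) 3 ((StdForm.antidiagonal 3).over L)) : GL (Fin 3) (mixedEmbedding.mixedSpace L)) :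
          Matrix (Fin 3) (Fin 3) (mixedEmbedding.mixedSpace L)) i j) = (A * M) i j := fun i j => by
      rw [hA, hM, ← Matrix.map_mul, Matrix.map_apply]
      rfl
    have hAij : ∀ j, evalC L ⟨w, IsTotallyComplex.isComplex w⟩ (((a : GL (Fin 3) (mixedEmbedding.mixedSpace L)) : Matrix (Fin 3) (Fin 3) (mixedEmbedding.mixedSpace L)) 2 j) = A 2 j :=
      fun j => rfl
    have hMij : ∀ i j, evalC L ⟨w, IsTotallyComplex.isComplex w⟩ (((k : GL (Fin 3) (mixedEmbedding.mixedSpace L)) : Matrix (Fin 3) (Fin 3) (mixedEmbedding.mixedSpace L)) i j) = M i j :=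
      fun i j => rfl
    obtain ⟨h12, h02, h00⟩ := evalC_apply_centro L k hk w
    change M 1 2 = M 1 0 at h12
    change M 0 2 = M 2 0 at h02
    change M 0 0 = M 2 2 at h00
    rw [hAM, hAM, hAij, hAij, hMij, hMij]
    simp only [Matrix.mul_apply, Fin.sum_univ_three]
    linear_combination (A 2 0) * h02 - (A 2 0) * h00 + (A 2 1) * h12
  · -- finite parts
    show (archLastRowL L (a * k)).2 = (archLastRowL L a).2 * (archLastRowL L k).2
    rw [archLastRowL_snd, archLastRowL_snd, archLastRowL_snd, mul_one]

/-- `ℓ(a)` is a unit of `𝔸_L` for every `a ∈ G_∞` (explicit inverse `((ℓ_w⁻¹)_w, 1)`, ★ 3c-E `archLastRowL_fst_ne_zero`). [cite: Rogawski1990, §1.10] -/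
theorem isUnit_archLastRowL (a : arch (↥(maximalRealSubfield L)) L (IsCMField.complexConj L) 3 ((StdForm.antidiagonal 3).over L)) : IsUnit (archLastRowL L a) :=
  ⟨⟨archLastRowL L a, (fun w : InfinitePlace L => ((archLastRowL L a).1 w)⁻¹, (1 : FiniteAdeleRing (𝓞 L) L)),
    (mul_eq_one_of_fst_inv_of_snd_one L (archLastRowL L a) (fun w : InfinitePlace L => ((archLastRowL L a).1 w)⁻¹, (1 : FiniteAdeleRing (𝓞 L) L))
      (archLastRowL_fst_ne_zero L a) (archLastRowL_snd L a) (fun _ => rfl) rfl).1,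
    (mul_eq_one_of_fst_inv_of_snd_one L (archLastRowL L a) (fun w : InfinitePlace L => ((archLastRowL L a).1 w)⁻¹, (1 : FiniteAdeleRing (𝓞 L) L))
      (archLastRowL_fst_ne_zero L a) (archLastRowL_snd L a) (fun _ => rfl) rfl).2⟩, rfl⟩

/-- `Θ(xy) = Θ(x)Θ(y)` for units `x, y` (★ 3a `lastRowChar_units_mul`). [cite: Rogawski1990, §1.10] -/
theorem lastRowChar_mul_of_isUnit (χ₁ : HeckeCharacter L) (χ₂ : ↥(TorusDict.torus (IsCMField.complexConj L)) →ₜ* ℂˣ) {x y : AdeleRing (𝓞 L) L}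
    (hx : IsUnit x) (hy : IsUnit y) : lastRowChar L χ₁ χ₂ (x * y) = lastRowChar L χ₁ χ₂ x * lastRowChar L χ₁ χ₂ y := by
  obtain ⟨X, rfl⟩ := hx
  obtain ⟨Y, rfl⟩ := hy
  rw [← Units.val_mul, lastRowChar_units_mul]

/-- **`Φa(a·k) = Φa(a)·Φa(k)`** for `a ∈ G_∞` and `ι(k) ∈ K` — the section of record is right-`K_∞`-equivariant by the character `Φa|K_∞` (`Φa = Θ(ℓ)·χ₂⟨det⟩` ★ `archSectionE_eq`, §2, `det`
multiplicative). [cite: Rogawski1990, §1.10] [cite: BorelJacquet1979, §4.1] -/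
theorem archSectionE_mul_of_mem (χ₁ : HeckeCharacter L) (χ₂ : ↥(TorusDict.torus (IsCMField.complexConj L)) →ₜ* ℂˣ)
    (a k : arch (↥(maximalRealSubfield L)) L (IsCMField.complexConj L) 3 ((StdForm.antidiagonal 3).over L))
    (hk : adelicVal (↥(maximalRealSubfield L)) L (IsCMField.complexConj L) 3 ((StdForm.antidiagonal 3).over L)
      (archToAdelic (↥(maximalRealSubfield L)) L (IsCMField.complexConj L) 3 ((StdForm.antidiagonal 3).over L) k) ∈ standardMaximalCompactGL 3 L) :
    archSectionE L χ₁ χ₂ (a * k) = archSectionE L χ₁ χ₂ a * archSectionE L χ₁ χ₂ k := by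
  have hdet : adelicDet (↥(maximalRealSubfield L)) L (IsCMField.complexConj L) 3 ((StdForm.antidiagonal 3).over L) (antidiagonal_over_det_ne_zero L 3)
        (archToAdelic (↥(maximalRealSubfield L)) L (IsCMField.complexConj L) 3 ((StdForm.antidiagonal 3).over L) (a * k)) =
      adelicDet (↥(maximalRealSubfield L)) L (IsCMField.complexConj L) 3 ((StdForm.antidiagonal 3).over L) (antidiagonal_over_det_ne_zero L 3)
          (archToAdelic (↥(maximalRealSubfield L)) L (IsCMField.complexConj L) 3 ((StdForm.antidiagonal 3).over L) a) *
        adelicDet (↥(maximalRealSubfield L)) L (IsCMField.complexConj L) 3 ((StdForm.antidiagonal 3).over L) (antidiagonal_over_det_ne_zero L 3)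
          (archToAdelic (↥(maximalRealSubfield L)) L (IsCMField.complexConj L) 3 ((StdForm.antidiagonal 3).over L) k) := by
    rw [map_mul]
    exact map_mul _ _ _
  rw [archSectionE_eq, archSectionE_eq, archSectionE_eq, archLastRowL_mul_of_mem L a k hk,
    lastRowChar_mul_of_isUnit L χ₁ χ₂ (isUnit_archLastRowL L a) (isUnit_archLastRowL L k), hdet, map_mul, Units.val_mul]
  ring

/-! ## §3 The level of record: the binders `hK'`, `hKinf`, `hU` -/

/-- **`hK'`: `levelOfRecord K_f ≤ K`.** [cite: BorelJacquet1979, §4.1] -/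
theorem levelOfRecord_le (Kf : Subgroup ↥(finAdelic (↥(maximalRealSubfield L)) L (IsCMField.complexConj L) 3 ((StdForm.antidiagonal 3).over L))) :
    levelOfRecord L Kf ≤ ((standardMaximalCompactGL 3 L).comap (adelicVal (↥(maximalRealSubfield L)) L (IsCMField.complexConj L) 3 ((StdForm.antidiagonal 3).over L)) :
      Subgroup (quasiSplit (↥(maximalRealSubfield L)) L (IsCMField.complexConj L) 3).Adelic) :=
  inf_le_left

/-- **`hKinf`: `ι(K_∞) ⊆ levelOfRecord K_f`** (`(ι k)_f = 1 ∈ K_f`). [cite: BorelJacquet1979, §4.1] -/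
theorem archToAdelic_mem_levelOfRecord (Kf : Subgroup ↥(finAdelic (↥(maximalRealSubfield L)) L (IsCMField.complexConj L) 3 ((StdForm.antidiagonal 3).over L)))
    (k : arch (↥(maximalRealSubfield L)) L (IsCMField.complexConj L) 3 ((StdForm.antidiagonal 3).over L))
    (hk : adelicVal (↥(maximalRealSubfield L)) L (IsCMField.complexConj L) 3 ((StdForm.antidiagonal 3).over L)
      (archToAdelic (↥(maximalRealSubfield L)) L (IsCMField.complexConj L) 3 ((StdForm.antidiagonal 3).over L) k) ∈ standardMaximalCompactGL 3 L) :
    archToAdelic (↥(maximalRealSubfield L)) L (IsCMField.complexConj L) 3 ((StdForm.antidiagonal 3).over L) k ∈ levelOfRecord L Kf := by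
  refine (mem_levelOfRecord_iff L Kf _).2 ⟨hk, ?_⟩
  rw [finPart_archToAdelic]
  exact Kf.one_mem

/-- `ι_f(k_f) ∈ K` for `k_f` in the integral level `G(𝒪̂)_f` (★ `GLn.ofFinite_mem_glIntegralLevel`, ★ `glIntegralLevel_le_standardMaximalCompactGL`). [cite: BorelJacquet1979, §4.1] -/
theorem adelicVal_finAdelicToAdelic_mem_standardMaximalCompactGL {kf : ↥(finAdelic (↥(maximalRealSubfield L)) L (IsCMField.complexConj L) 3 ((StdForm.antidiagonal 3).over L))}
    (hkf : kf ∈ finAdelicIntegralLevel (↥(maximalRealSubfield L)) L (IsCMField.complexConj L) 3 ((StdForm.antidiagonal 3).over L)) :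
    adelicVal (↥(maximalRealSubfield L)) L (IsCMField.complexConj L) 3 ((StdForm.antidiagonal 3).over L)
      (finAdelicToAdelic (↥(maximalRealSubfield L)) L (IsCMField.complexConj L) 3 ((StdForm.antidiagonal 3).over L) kf) ∈ standardMaximalCompactGL 3 L := by
  rw [adelicVal_finAdelicToAdelic]
  exact glIntegralLevel_le_standardMaximalCompactGL (GLn.ofFinite_mem_glIntegralLevel ((mem_finAdelicIntegralLevel_iff _ _ _ _ _ kf).1 hkf))

/-- **`ι_f(K_f) ⊆ levelOfRecord K_f`** for `K_f ≤ G(𝒪̂)_f`. [cite: BorelJacquet1979, §4.1] -/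
theorem finAdelicToAdelic_mem_levelOfRecord {Kf : Subgroup ↥(finAdelic (↥(maximalRealSubfield L)) L (IsCMField.complexConj L) 3 ((StdForm.antidiagonal 3).over L))}
    (hKf : Kf ≤ finAdelicIntegralLevel (↥(maximalRealSubfield L)) L (IsCMField.complexConj L) 3 ((StdForm.antidiagonal 3).over L))
    {kf : ↥(finAdelic (↥(maximalRealSubfield L)) L (IsCMField.complexConj L) 3 ((StdForm.antidiagonal 3).over L))} (hkf : kf ∈ Kf) :
    finAdelicToAdelic (↥(maximalRealSubfield L)) L (IsCMField.complexConj L) 3 ((StdForm.antidiagonal 3).over L) kf ∈ levelOfRecord L Kf := by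
  refine (mem_levelOfRecord_iff L Kf _).2 ⟨adelicVal_finAdelicToAdelic_mem_standardMaximalCompactGL L (hKf hkf), ?_⟩
  rw [finPart_finAdelicToAdelic]
  exact hkf

/-- **`hU`: `ω = 1` on `ι_f(K_f)`** (`(ι_f k_f)_∞ = 1`, `Φa(1) = 1`). [cite: BorelJacquet1979, §4.1] -/
theorem omegaOfRecord_eq_one_of_archPart_eq_one (χ₁ : HeckeCharacter L) (χ₂ : ↥(TorusDict.torus (IsCMField.complexConj L)) →ₜ* ℂˣ)
    (Kf : Subgroup ↥(finAdelic (↥(maximalRealSubfield L)) L (IsCMField.complexConj L) 3 ((StdForm.antidiagonal 3).over L))) (k : ↥(levelOfRecord L Kf))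
    (hk : archPart (↥(maximalRealSubfield L)) L (IsCMField.complexConj L) 3 ((StdForm.antidiagonal 3).over L) (k : (quasiSplit (↥(maximalRealSubfield L)) L (IsCMField.complexConj L) 3).Adelic) = 1) :
    omegaOfRecord L χ₁ χ₂ Kf k = 1 := by
  rw [omegaOfRecord_apply, hk, archSectionE_one]

/-- `hU` in the exports' form: every `k_f ∈ K_f` (`K_f ≤ G(𝒪̂)_f`) has `ι_f k_f ∈ K′` and `ω(ι_f k_f) = 1`. [cite: BorelJacquet1979, §4.1] -/
theorem exists_mem_levelOfRecord_omegaOfRecord_eq_one (χ₁ : HeckeCharacter L) (χ₂ : ↥(TorusDict.torus (IsCMField.complexConj L)) →ₜ* ℂˣ)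
    {Kf : Subgroup ↥(finAdelic (↥(maximalRealSubfield L)) L (IsCMField.complexConj L) 3 ((StdForm.antidiagonal 3).over L))}
    (hKf : Kf ≤ finAdelicIntegralLevel (↥(maximalRealSubfield L)) L (IsCMField.complexConj L) 3 ((StdForm.antidiagonal 3).over L))
    {kf : ↥(finAdelic (↥(maximalRealSubfield L)) L (IsCMField.complexConj L) 3 ((StdForm.antidiagonal 3).over L))} (hkf : kf ∈ Kf) :
    ∃ hk : finAdelicToAdelic (↥(maximalRealSubfield L)) L (IsCMField.complexConj L) 3 ((StdForm.antidiagonal 3).over L) kf ∈ levelOfRecord L Kf,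
      omegaOfRecord L χ₁ χ₂ Kf ⟨_, hk⟩ = 1 :=
  ⟨finAdelicToAdelic_mem_levelOfRecord L hKf hkf, omegaOfRecord_eq_one_of_archPart_eq_one L χ₁ χ₂ Kf _ (archPart_finAdelicToAdelic _ _ _ _ _ kf)⟩

/-- `k ∈ K ⇒ ι(k_∞) ∈ K` (`(ι(k_∞))_∞ = k_∞ ∈ K_∞` ★ `toMixed_mem_Kinf_of_mem_standardMaximalCompactGL`, ★ `map_Kinf_le_standardMaximalCompactGL`). [cite: BorelJacquet1979, §4.1] -/
theorem adelicVal_archToAdelic_archPart_mem {k : (quasiSplit (↥(maximalRealSubfield L)) L (IsCMField.complexConj L) 3).Adelic}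
    (hk : adelicVal (↥(maximalRealSubfield L)) L (IsCMField.complexConj L) 3 ((StdForm.antidiagonal 3).over L) k ∈ standardMaximalCompactGL 3 L) :
    adelicVal (↥(maximalRealSubfield L)) L (IsCMField.complexConj L) 3 ((StdForm.antidiagonal 3).over L)
      (archToAdelic (↥(maximalRealSubfield L)) L (IsCMField.complexConj L) 3 ((StdForm.antidiagonal 3).over L)
        (archPart (↥(maximalRealSubfield L)) L (IsCMField.complexConj L) 3 ((StdForm.antidiagonal 3).over L) k)) ∈ standardMaximalCompactGL 3 L := by
  rw [adelicVal_archToAdelic, coe_archPart]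
  exact map_Kinf_le_standardMaximalCompactGL (Subgroup.mem_map_of_mem _ (toMixed_mem_Kinf_of_mem_standardMaximalCompactGL hk))

/-! ## §4 The witness at the level of record -/

/-- **`g ↦ Φa(g_∞)·Φf(g_f)` lies in `chiSectionSpacePair χ₁ χ₂ (levelOfRecord K_f) (omegaOfRecord χ₁ χ₂ K_f)`** for every finite section `Φf` with the Borel law (`hΦfB`) and right-`K_f`-invariance
(`hΦfK`): the left law is ★ `archFin_isChiSectionPair` (letters `hΦaB` ★ 3c-E, `hc` ★ FILE 2 splitting), the right law is §2 (`Φa(g_∞k_∞) = Φa(g_∞)Φa(k_∞)`) times `hΦfK`.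
[cite: MoeglinWaldspurger1995, I.2.17] [cite: BorelJacquet1979, §4.1] -/
theorem archFin_mem_chiSectionSpacePair_levelOfRecord (χ₁ : HeckeCharacter L) (χ₂ : ↥(TorusDict.torus (IsCMField.complexConj L)) →ₜ* ℂˣ)
    (Kf : Subgroup ↥(finAdelic (↥(maximalRealSubfield L)) L (IsCMField.complexConj L) 3 ((StdForm.antidiagonal 3).over L)))
    (Φf : ↥(finAdelic (↥(maximalRealSubfield L)) L (IsCMField.complexConj L) 3 ((StdForm.antidiagonal 3).over L)) → ℂ)
    (hΦfB : ∀ (b : (quasiSplit (↥(maximalRealSubfield L)) L (IsCMField.complexConj L) 3).Adelic) (hb : b ∈ borelAdelic (↥(maximalRealSubfield L)) L (IsCMField.complexConj L) 3)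
        (u : ↥(finAdelic (↥(maximalRealSubfield L)) L (IsCMField.complexConj L) 3 ((StdForm.antidiagonal 3).over L))),
      Φf (finPart (↥(maximalRealSubfield L)) L (IsCMField.complexConj L) 3 ((StdForm.antidiagonal 3).over L) b * u) =
        (((χ₁ (firstEntryUnit (finAdelicToAdelic_finPart_mem_borelAdelic L hb)) : ℂˣ) : ℂ) * ((χ₂ (middleEntryUnitary (finAdelicToAdelic_finPart_mem_borelAdelic L hb)) : ℂˣ) : ℂ)) * Φf u)
    (hΦfK : ∀ u, ∀ k ∈ Kf, Φf (u * k) = Φf u) :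
    (fun g : (quasiSplit (↥(maximalRealSubfield L)) L (IsCMField.complexConj L) 3).Adelic =>
      archSectionE L χ₁ χ₂ (archPart (↥(maximalRealSubfield L)) L (IsCMField.complexConj L) 3 ((StdForm.antidiagonal 3).over L) g) *
        Φf (finPart (↥(maximalRealSubfield L)) L (IsCMField.complexConj L) 3 ((StdForm.antidiagonal 3).over L) g)) ∈
      chiSectionSpacePair χ₁ χ₂ (levelOfRecord L Kf) (omegaOfRecord L χ₁ χ₂ Kf) := by
  classical
  refine mem_chiSectionSpacePair (archFin_isChiSectionPair L (χ₁ := χ₁) (χ₂ := χ₂)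
      (fun b => if hb : b ∈ borelAdelic (↥(maximalRealSubfield L)) L (IsCMField.complexConj L) 3 then
        ((χ₁ (firstEntryUnit (archToAdelic_archPart_mem_borelAdelic L hb)) : ℂˣ) : ℂ) * ((χ₂ (middleEntryUnitary (archToAdelic_archPart_mem_borelAdelic L hb)) : ℂˣ) : ℂ)
        else 0)
      (fun b => if hb : b ∈ borelAdelic (↥(maximalRealSubfield L)) L (IsCMField.complexConj L) 3 then
        ((χ₁ (firstEntryUnit (finAdelicToAdelic_finPart_mem_borelAdelic L hb)) : ℂˣ) : ℂ) * ((χ₂ (middleEntryUnitary (finAdelicToAdelic_finPart_mem_borelAdelic L hb)) : ℂˣ) : ℂ)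
        else 0)
      (archSectionE L χ₁ χ₂) Φf
      (fun b hb => by simp only [dif_pos hb]; exact (borelPairChar_eq_arch_mul_fin L χ₁ χ₂ hb).symm)
      (fun b hb a => by simp only [dif_pos hb]; exact archSectionE_archPart_mul L χ₁ χ₂ hb a)
      (fun b hb u => by simp only [dif_pos hb]; exact hΦfB b hb u)) fun g k => ?_
  · have hk := (mem_levelOfRecord_iff L Kf _).1 k.2
    show archSectionE L χ₁ χ₂ (archPart (↥(maximalRealSubfield L)) L (IsCMField.complexConj L) 3 ((StdForm.antidiagonal 3).over L)
          (g * (k : (quasiSplit (↥(maximalRealSubfield L)) L (IsCMField.complexConj L) 3).Adelic))) *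
        Φf (finPart (↥(maximalRealSubfield L)) L (IsCMField.complexConj L) 3 ((StdForm.antidiagonal 3).over L)
          (g * (k : (quasiSplit (↥(maximalRealSubfield L)) L (IsCMField.complexConj L) 3).Adelic))) =
      omegaOfRecord L χ₁ χ₂ Kf k *
        (archSectionE L χ₁ χ₂ (archPart (↥(maximalRealSubfield L)) L (IsCMField.complexConj L) 3 ((StdForm.antidiagonal 3).over L) g) *
          Φf (finPart (↥(maximalRealSubfield L)) L (IsCMField.complexConj L) 3 ((StdForm.antidiagonal 3).over L) g))
    rw [map_mul, map_mul, archSectionE_mul_of_mem L χ₁ χ₂ _ _ (adelicVal_archToAdelic_archPart_mem L hk.1), hΦfK _ _ hk.2, omegaOfRecord_apply]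
    ring

/-- **THE WITNESS AT THE LEVEL OF RECORD** (S8-R181): for an open `K_f ≤ G(𝒪̂)_f` on whose Borel elements the pair character dies there is `φ ∈ chiSectionSpacePair χ₁ χ₂ (levelOfRecord K_f)
(omegaOfRecord χ₁ χ₂ K_f)`, continuous, `φ(1) = 1`, with archimedean restriction THE SECTION OF RECORD `φ ∘ ι = archSectionE χ₁ χ₂` (★ p863484 `Φf` with `Φf(1) = 1`).
[cite: MoeglinWaldspurger1995, I.2.17] [cite: BorelJacquet1979, §4.1] [cite: Rogawski1990, §1.10] -/
theorem exists_mem_chiSectionSpacePair_levelOfRecord (χ₁ : HeckeCharacter L) (χ₂ : ↥(TorusDict.torus (IsCMField.complexConj L)) →ₜ* ℂˣ)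
    (Kf : Subgroup ↥(finAdelic (↥(maximalRealSubfield L)) L (IsCMField.complexConj L) 3 ((StdForm.antidiagonal 3).over L)))
    (hKo : IsOpen ((Kf : Subgroup ↥(finAdelic (↥(maximalRealSubfield L)) L (IsCMField.complexConj L) 3 ((StdForm.antidiagonal 3).over L))) :
      Set ↥(finAdelic (↥(maximalRealSubfield L)) L (IsCMField.complexConj L) 3 ((StdForm.antidiagonal 3).over L))))
    (hKχ : ∀ k ∈ Kf, ∀ (hk : finAdelicToAdelic (↥(maximalRealSubfield L)) L (IsCMField.complexConj L) 3 ((StdForm.antidiagonal 3).over L) k ∈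
        borelAdelic (↥(maximalRealSubfield L)) L (IsCMField.complexConj L) 3),
      ((χ₁ (firstEntryUnit hk) : ℂˣ) : ℂ) * ((χ₂ (middleEntryUnitary hk) : ℂˣ) : ℂ) = 1) :
    ∃ φ : (quasiSplit (↥(maximalRealSubfield L)) L (IsCMField.complexConj L) 3).Adelic → ℂ,
      φ ∈ chiSectionSpacePair χ₁ χ₂ (levelOfRecord L Kf) (omegaOfRecord L χ₁ χ₂ Kf) ∧ Continuous φ ∧ φ 1 = 1 ∧
        ∀ a : arch (↥(maximalRealSubfield L)) L (IsCMField.complexConj L) 3 ((StdForm.antidiagonal 3).over L),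
          φ (archToAdelic (↥(maximalRealSubfield L)) L (IsCMField.complexConj L) 3 ((StdForm.antidiagonal 3).over L) a) = archSectionE L χ₁ χ₂ a := by
  obtain ⟨Φf, hΦfc, hΦfB, hΦfK, hΦf1⟩ := exists_finLevelSection L χ₁ χ₂ Kf hKo hKχ
  refine ⟨_, archFin_mem_chiSectionSpacePair_levelOfRecord L χ₁ χ₂ Kf Φf hΦfB hΦfK, continuous_archFin L (archSectionE L χ₁ χ₂) Φf (continuous_archSectionE L χ₁ χ₂) hΦfc, ?_,
    fun a => ?_⟩
  · show archSectionE L χ₁ χ₂ (archPart (↥(maximalRealSubfield L)) L (IsCMField.complexConj L) 3 ((StdForm.antidiagonal 3).over L) 1) *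
        Φf (finPart (↥(maximalRealSubfield L)) L (IsCMField.complexConj L) 3 ((StdForm.antidiagonal 3).over L) 1) = 1
    rw [map_one, map_one, archSectionE_one, hΦf1, mul_one]
  · show archSectionE L χ₁ χ₂ (archPart (↥(maximalRealSubfield L)) L (IsCMField.complexConj L) 3 ((StdForm.antidiagonal 3).over L)
          (archToAdelic (↥(maximalRealSubfield L)) L (IsCMField.complexConj L) 3 ((StdForm.antidiagonal 3).over L) a)) *
        Φf (finPart (↥(maximalRealSubfield L)) L (IsCMField.complexConj L) 3 ((StdForm.antidiagonal 3).over L)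
          (archToAdelic (↥(maximalRealSubfield L)) L (IsCMField.complexConj L) 3 ((StdForm.antidiagonal 3).over L) a)) = archSectionE L χ₁ χ₂ a
    rw [archPart_archToAdelic, finPart_archToAdelic, hΦf1, mul_one]

/-- **THE WITNESS OF RECORD, HYPOTHESIS-FREE** (S8-R181 «2b export list»): for EVERY pair `(χ₁, χ₂)` there are a conductor level `𝔫 ≠ 0` (★ 2b) and `φ ∈ chiSectionSpacePair χ₁ χ₂
(levelOfRecord K(𝔫)_f) (omegaOfRecord χ₁ χ₂ K(𝔫)_f)`, continuous, `φ(1) = 1`, `φ ∘ ι = archSectionE χ₁ χ₂`; the level binders of the (V)(i) exports are §3: `levelOfRecord_le` (`hK'`),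
`archToAdelic_mem_levelOfRecord` (`hKinf`), `exists_mem_levelOfRecord_omegaOfRecord_eq_one` with ★ `finCongruenceLevel_le_integralLevel`, ★ `isOpen_finCongruenceLevel`, ★
`isCompact_finCongruenceLevel` (`U₀ = K(𝔫)_f`, `hU`). [cite: MoeglinWaldspurger1995, I.2.17] [cite: BorelJacquet1979, §4.1] [cite: Rogawski1990, §1.10] -/
theorem exists_level_mem_chiSectionSpacePair_levelOfRecord (χ₁ : HeckeCharacter L) (χ₂ : ↥(TorusDict.torus (IsCMField.complexConj L)) →ₜ* ℂˣ) :
    ∃ 𝔫 : Ideal (𝓞 L), 𝔫 ≠ 0 ∧ ∃ φ : (quasiSplit (↥(maximalRealSubfield L)) L (IsCMField.complexConj L) 3).Adelic → ℂ,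
      φ ∈ chiSectionSpacePair χ₁ χ₂ (levelOfRecord L (finCongruenceLevel (↥(maximalRealSubfield L)) L (IsCMField.complexConj L) 3 ((StdForm.antidiagonal 3).over L) 𝔫))
          (omegaOfRecord L χ₁ χ₂ (finCongruenceLevel (↥(maximalRealSubfield L)) L (IsCMField.complexConj L) 3 ((StdForm.antidiagonal 3).over L) 𝔫)) ∧
        Continuous φ ∧ φ 1 = 1 ∧
          ∀ a : arch (↥(maximalRealSubfield L)) L (IsCMField.complexConj L) 3 ((StdForm.antidiagonal 3).over L),
            φ (archToAdelic (↥(maximalRealSubfield L)) L (IsCMField.complexConj L) 3 ((StdForm.antidiagonal 3).over L) a) = archSectionE L χ₁ χ₂ a := by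
  obtain ⟨𝔫, h𝔫, h⟩ := exists_finCongruenceLevel_borelPairChar_eq_one L χ₁ χ₂
  exact ⟨𝔫, h𝔫, exists_mem_chiSectionSpacePair_levelOfRecord L χ₁ χ₂ _
    (isOpen_finCongruenceLevel (↥(maximalRealSubfield L)) L (IsCMField.complexConj L) 3 ((StdForm.antidiagonal 3).over L) h𝔫) h⟩

end Summit.HodgeConjecture.HodgeConjecture.R90.S8

end
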